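/-
Copyright: H21 programme, solo seat `solo-RiemannHypothesis-informed` (session 4).
-/
import Summits.RiemannHypothesis.RiemannHypothesis.Theorems.SoloInformedEffSampling
import Summits.RiemannHypothesis.RiemannHypothesis.Theorems.SoloInformedLocalThreshold

/-!
# Effective sampling chain, II (solo-informed, T23)

T12, T13, T13′ with `A₁ = zetaDensityConst` (proofs verbatim from `SoloInformedLocalSampling`,
`SoloInformedLocalThreshold`).
-/

open MeasureTheory Complex Set Filter Topology Literature.NumberTheory.LFunctions
open scoped ContDiff ComplexConjugate

namespace Summit.RiemannHypothesis.RiemannHypothesis.Theorems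

/-- **T12, effective.** The local upper bound for the ground-state defect of an odd dipole with
`A₁ = zetaDensityConst`. -/
theorem weilGroundEnergy_le_local_of_oddDipole_eff :
    ∀ (h : ℝ → ℂ) (a τ η γ₀ R : ℝ) (n : ℕ), IsWeilTest h →
      (∀ t, h (-t) = -h t) → 0 ≤ a → 1 ≤ R → tsupport h ⊆ Icc (-a) a →
      0 < ∫ t, ‖weilDodge τ h t‖ ^ 2 → riemannZeta (1 / 2 + η + γ₀ * I) = 0 → |η| < 1 / 2 →
      η ≠ 0 → γ₀ ≠ 0 →
      (∀ ρ : ℂ, riemannZeta ρ = 0 → 0 ≤ ρ.re → ρ.re ≤ 1 → |ρ.im - γ₀| < R → ρ.re ≠ 1 / 2 →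
          ρ = 1 / 2 + η + γ₀ * I ∨ ρ = 1 / 2 - η + γ₀ * I) →
        weilGroundEnergy a ≤
          (2 * zetaDensityConst * (((∫ t : ℝ, ‖weilDodge τ h t‖) ^ 2
              + (∫ t : ℝ, ‖deriv (weilDodge τ h) t‖) ^ 2)
                + 2 * Real.exp a * (∫ t : ℝ, ‖iteratedDeriv (n + 1) (weilDodge τ h) t‖) ^ 2
                    / R ^ (2 * n)) * Real.log (|γ₀| + 2)
            - 2 * ((riemannZetaZeroOrder (1 / 2 + η + γ₀ * I) : ℝ)
                * ((η ^ 2 + τ ^ 2) ^ 2 * ‖∫ t : ℝ, h t * cexp ((η : ℂ) * t)‖ ^ 2)))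
            / ∫ t, ‖weilDodge τ h t‖ ^ 2 := by
  intro h a τ η γ₀ R n hh hodd ha hR hhs hpos hζ hη hη0 hγ hloc
  have hS := weilSamplingEnergy_le_local_eff
  set A₁ : ℝ := zetaDensityConst
  have _hA₁ : 0 < A₁ := zetaDensityConst_pos
  classical
  set ρ₀ : ℂ := 1 / 2 + η + γ₀ * I with hρ₀
  set ρ₁ : ℂ := 1 / 2 - η + γ₀ * I with hρ₁
  set G : ℝ := (η ^ 2 + τ ^ 2) ^ 2 * ‖∫ t : ℝ, h t * cexp ((η : ℂ) * t)‖ ^ 2 with hG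
  have hkW : IsWeilTest (weilDodge τ h) := isWeilTest_weilDodge hh τ
  have hks : tsupport (weilDodge τ h) ⊆ Icc (-a) a := (tsupport_weilDodge_subset τ h).trans hhs
  have hne : ρ₀ ≠ ρ₁ := by
    intro h01
    have := congrArg Complex.re h01
    simp [hρ₀, hρ₁] at this
    exact hη0 (by linarith)
  have hρ₀1 : ρ₀ ≠ 1 := by
    intro h1
    have := congrArg Complex.im h1
    simp [hρ₀] at this
    exact hγ this
  have hρ₁1 : ρ₁ ≠ 1 := by
    intro h1
    have := congrArg Complex.im h1
    simp [hρ₁] at this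
    exact hγ this
  have hS1 : ∀ ρ ∈ ({ρ₀, ρ₁} : Finset ℂ), ρ ≠ 1 := by
    intro ρ hρ
    rcases Finset.mem_insert.mp hρ with h0 | h1
    · rw [h0]; exact hρ₀1
    · rw [Finset.mem_singleton.mp h1]; exact hρ₁1
  have hloc' : ∀ ρ : ℂ, riemannZeta ρ = 0 → 0 ≤ ρ.re → ρ.re ≤ 1 → |ρ.im - γ₀| < R →
      ρ ∉ ({ρ₀, ρ₁} : Finset ℂ) → ρ.re = 1 / 2 := by
    intro ρ hz h0 h1 hnear hρS
    by_contra hre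
    rcases hloc ρ hz h0 h1 hnear hre with h | h
    · exact hρS (by rw [h]; simp)
    · exact hρS (by rw [h]; simp)
  have hB := hS (weilDodge τ h) a γ₀ R n {ρ₀, ρ₁} hkW ha hR hks hS1 hloc'
  -- the two exceptional values
  have e1 : ∀ (f : ℝ → ℂ) (c : ℝ), ∫ t : ℝ, f t * cexp ((c : ℂ) * t) = weilMellin f (1 / 2 + c) := by
    intro f c; unfold weilMellin; congr 1 with t; congr 2; ring
  have hfac : ∀ c : ℝ, (-((1 : ℂ) / 2 + c - 1 / 2) ^ 2 - (τ : ℂ) ^ 2) =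
      ((-(c ^ 2 + τ ^ 2) : ℝ) : ℂ) := by
    intro c; push_cast; ring
  have hval : ∀ c : ℝ, ‖weilMellin (fun t ↦ weilDodge τ h t * cexp (-(γ₀ * I) * t))
      (1 / 2 + c + γ₀ * I)‖ ^ 2 = (c ^ 2 + τ ^ 2) ^ 2 * ‖∫ t : ℝ, h t * cexp ((c : ℂ) * t)‖ ^ 2 := by
    intro c
    rw [weilMellin_mul_cexp]
    have e0 : (1 / 2 + (c : ℂ) + γ₀ * I + -(γ₀ * I)) = 1 / 2 + c := by ring
    rw [e0, weilMellin_weilDodge (contDiff_two_of_isWeilTest hh) hh.2, norm_mul, mul_pow, hfac c,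
      Complex.norm_real, Real.norm_eq_abs, sq_abs, e1]
    ring
  have hval0 : ‖weilMellin (fun t ↦ weilDodge τ h t * cexp (-(γ₀ * I) * t)) ρ₀‖ ^ 2 = G := by
    rw [hρ₀, hval η]
  have hval1 : ‖weilMellin (fun t ↦ weilDodge τ h t * cexp (-(γ₀ * I) * t)) ρ₁‖ ^ 2 = G := by
    have e : ρ₁ = 1 / 2 + ((-η : ℝ) : ℂ) + γ₀ * I := by rw [hρ₁]; push_cast; ring
    rw [e, hval (-η), hG]
    have hint : ∫ t : ℝ, h t * cexp (((-η : ℝ) : ℂ) * t) = -∫ t : ℝ, h t * cexp ((η : ℂ) * t) := by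
      rw [← integral_odd_mul_cexp_neg hodd η]
      congr 1 with t; push_cast; ring_nf
    rw [hint, norm_neg]
    ring
  have hm1 : (riemannZetaZeroOrder ρ₁ : ℝ) = riemannZetaZeroOrder ρ₀ := by
    have e : ρ₁ = conj (1 - ρ₀) := by
      apply Complex.ext
      · simp [hρ₀, hρ₁]; ring
      · simp [hρ₀, hρ₁]
    have h0 : 0 < ρ₀.re := by
      have := (abs_lt.mp hη).1
      simp [hρ₀]; linarith
    have h1 : ρ₀.re < 1 := by
      have := (abs_lt.mp hη).2
      simp [hρ₀]; linarith
    rw [e, riemannZetaZeroOrder_conj_holds (1 - ρ₀), riemannZetaZeroOrder_one_sub_holds h0 h1]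
  have hsum : ∑ ρ ∈ ({ρ₀, ρ₁} : Finset ℂ), (riemannZetaZeroOrder ρ : ℝ) *
      ‖weilMellin (fun t ↦ weilDodge τ h t * cexp (-(γ₀ * I) * t)) ρ‖ ^ 2 =
      2 * ((riemannZetaZeroOrder ρ₀ : ℝ) * G) := by
    rw [Finset.sum_pair hne, hval0, hval1, hm1]
    ring
  simp_rw [hsum] at hB
  have key := weilGroundEnergy_le_of_oddDipole_weilDodge hh hodd hhs τ hpos hζ hη.le hγ hB
  refine key.trans_eq ?_
  congr 1
  ring

/-- **T13, effective.** Threshold form with `A₁ = zetaDensityConst`. -/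
theorem weilGroundEnergy_neg_of_local_oddDipole_eff :
    ∀ (h : ℝ → ℂ) (a τ η γ₀ R : ℝ) (n : ℕ), IsWeilTest h →
      (∀ t, h (-t) = -h t) → 0 ≤ a → 1 ≤ R → tsupport h ⊆ Icc (-a) a →
      0 < ∫ t, ‖weilDodge τ h t‖ ^ 2 → riemannZeta (1 / 2 + η + γ₀ * I) = 0 → |η| < 1 / 2 →
      η ≠ 0 → γ₀ ≠ 0 →
      (∀ ρ : ℂ, riemannZeta ρ = 0 → 0 ≤ ρ.re → ρ.re ≤ 1 → |ρ.im - γ₀| < R → ρ.re ≠ 1 / 2 →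
          ρ = 1 / 2 + η + γ₀ * I ∨ ρ = 1 / 2 - η + γ₀ * I) →
      2 * zetaDensityConst * (((∫ t : ℝ, ‖weilDodge τ h t‖) ^ 2
          + (∫ t : ℝ, ‖deriv (weilDodge τ h) t‖) ^ 2)
            + 2 * Real.exp a * (∫ t : ℝ, ‖iteratedDeriv (n + 1) (weilDodge τ h) t‖) ^ 2
                / R ^ (2 * n)) * Real.log (|γ₀| + 2)
        < 2 * ((riemannZetaZeroOrder (1 / 2 + η + γ₀ * I) : ℝ)
            * ((η ^ 2 + τ ^ 2) ^ 2 * ‖∫ t : ℝ, h t * cexp ((η : ℂ) * t)‖ ^ 2)) →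
        weilGroundEnergy a < 0 := by
  intro h a τ η γ₀ R n hh hodd ha hR hhs hpos hζ hη hη0 hγ hloc hwin
  have hT := weilGroundEnergy_le_local_of_oddDipole_eff
  have key := hT h a τ η γ₀ R n hh hodd ha hR hhs hpos hζ hη hη0 hγ hloc
  exact key.trans_lt (div_neg_of_neg_of_pos (by linarith) hpos)

/-- **T13′, effective.** Exclusion form with `A₁ = zetaDensityConst`. -/
theorem pair_gain_le_of_weilGroundEnergy_nonneg_eff :
    ∀ (h : ℝ → ℂ) (a τ η γ₀ R : ℝ) (n : ℕ), IsWeilTest h →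
      (∀ t, h (-t) = -h t) → 0 ≤ a → 1 ≤ R → tsupport h ⊆ Icc (-a) a →
      0 < ∫ t, ‖weilDodge τ h t‖ ^ 2 → riemannZeta (1 / 2 + η + γ₀ * I) = 0 → |η| < 1 / 2 →
      η ≠ 0 → γ₀ ≠ 0 →
      (∀ ρ : ℂ, riemannZeta ρ = 0 → 0 ≤ ρ.re → ρ.re ≤ 1 → |ρ.im - γ₀| < R → ρ.re ≠ 1 / 2 →
          ρ = 1 / 2 + η + γ₀ * I ∨ ρ = 1 / 2 - η + γ₀ * I) →
      0 ≤ weilGroundEnergy a →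
        2 * ((riemannZetaZeroOrder (1 / 2 + η + γ₀ * I) : ℝ)
            * ((η ^ 2 + τ ^ 2) ^ 2 * ‖∫ t : ℝ, h t * cexp ((η : ℂ) * t)‖ ^ 2))
          ≤ 2 * zetaDensityConst * (((∫ t : ℝ, ‖weilDodge τ h t‖) ^ 2
                + (∫ t : ℝ, ‖deriv (weilDodge τ h) t‖) ^ 2)
              + 2 * Real.exp a * (∫ t : ℝ, ‖iteratedDeriv (n + 1) (weilDodge τ h) t‖) ^ 2
                  / R ^ (2 * n)) * Real.log (|γ₀| + 2) := by
  intro h a τ η γ₀ R n hh hodd ha hR hhs hpos hζ hη hη0 hγ hloc hε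
  have hT := weilGroundEnergy_neg_of_local_oddDipole_eff
  by_contra hlt
  exact absurd hε (not_le.mpr (hT h a τ η γ₀ R n hh hodd ha hR hhs hpos hζ hη hη0 hγ hloc
    (not_le.mp hlt)))

end Summit.RiemannHypothesis.RiemannHypothesis.Theorems
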